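import Literature.NumberTheory.EllipticCurves.PointCountEulerCriterion
import Literature.NumberTheory.EllipticCurves.CongruentNumberCurveSupersingular
import HarnessLib

/-!
# Point counts of the `j = 8000` family `B_n : y² = x³ + 4n x² + 2n² x` (CM by `ℤ[√-2]`): the supersingular
# primes `p ≡ 5, 7 (mod 8)` (Williams 1978) and the reduction to Brewer's character sum

Topic `Literature/NumberTheory/EllipticCurves`, namespace `Literature.NumberTheory.EllipticCurves.SqrtTwoTwist`.
THEOREMS ONLY (no definition, no named fact).  The `ℤ[√-2]`-twin of `CongruentNumberCurveSupersingular` (`ℤ[i]`,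
`y² = x³ − Dx`) and `MordellCurveSupersingular` (`ℤ[ω]`, `y² = x³ + k`); first file of the Hecke-theta dictionary for
`L(B_n, s)`.

The curve `B : y² = x³ + 4x² + 2x` (Cremona `256d1`; Silverman, *Advanced Topics* II.2.3.1(ii); the tree's model of the
maximal CM `j`-invariant `8000`, `DeuringSplitOrdinarySqrtTwoProofs`) and its quadratic twists
`B_n = ⟨0, 4n, 0, 2n², 0⟩ : y² = x³ + 4n x² + 2n² x = x(x² + 4nx + 2n²)` (`n ∈ ℤ ∖ 0`; Rajwade's `y² = x(x² − 4ax + 2a²)` with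
`a = −n`) are the elliptic curves over `ℚ` with complex multiplication by `ℤ[√-2]`.  Over a finite field `F` of odd
characteristic `#B_n(F) = |F| + 1 + Σ_x χ(x³ + 4n x² + 2n² x)` (`χ` the quadratic character,
`natCard_point_eq_card_add_one_add_sum`), and:

* §2 `sum_quadraticChar_twist` — the twist law `Σ_x χ(x³ + a n x² + b n² x) = χ(n) Σ_x χ(x³ + a x² + b x)` (`x ↦ nx`);
* §3 ★ `sum_quadraticChar_B_eq_zero` — **if `χ(−2) = −1` then `Σ_x χ(x³ + 4x² + 2x) = 0`** (Williams' five-line proof,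
  PAMS 71 (1978): for `x ≠ 0` the summand is `χ(x + 4 + 2/x)`; grouping by `y = x + 2/x`, whose fibre has `1 + χ(y² − 8)`
  elements, gives `Σ_y χ((y + 4)(y² − 8))`, and `y = −2(z + 2)` shows this equals `χ(−2)` times the original sum), hence
  `#B_n(F) = |F| + 1` whenever `|F| ≡ 5, 7 (mod 8)` (`natCard_point_B_eq_of_card_mod_eight`);
* §4 over `ℤ/p`: ★ **`a_p(B_n) = 0` for every prime `p ≡ 5, 7 (mod 8)`, `p ∤ n`**, on Mathlib's `WeierstrassCurve.LFunction`
  (`lFunction_B_apply_prime_eq_zero`, through the tree's `lFunction_map_apply_prime_of_not_dvd` on the `ℤ`-model,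
  `Δ = 2⁹ n⁶`); these are the primes inert in `ℚ(√-2)` — the supersingular half of Deuring's theorem for `j = 8000`, here
  with an elementary proof;
* §5 the split primes `p ≡ 1, 3 (mod 8)`: `Σ_x χ(x³ + 4x² + 2x) = χ(−1) · Σ_x χ((x + 2)(x² − 2))` (`x ↦ −x − 2`), the
  right-hand sum being BREWER'S CHARACTER SUM `B`, evaluated in print as `2c` where `p = c² + 2d²`,
  `c ≡ (−1)^{k+1} (mod 4)`, `p = 8k + 1` or `8k + 3` (Brewer 1961; Whiteman 1963; Rajwade 1968; Leonard–Williams 1975, by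
  Jacobi sums of order `8` over `𝔽_p` for `p ≡ 1 (8)` and Eisenstein sums over `𝔽_{p²}` for `p ≡ 3 (8)`).  That evaluation
  is the named fact of the sequel `SqrtTwoTwistBrewer` (not proved in the tree); with it `a_p(B_n) = −(−n/p) · 2c`,
  equivalently (Rajwade; Silverberg 2010 Thm. 2.7) `a_p(B_n) = (−n/p)(π + π̄)`, `p = ππ̄`,
  `π ≡ 1, 3, 1 ± √-2, 3 ± √-2, 5 + 2√-2, 7 + 2√-2 (mod 4√-2)`.  Here only `B = 0` for `χ(−2) = −1` is recorded
  (`sum_quadraticChar_brewer_eq_zero`, Brewer's first clause).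

The tree's `Deuring1941_frobeniusTrace_eq_add_conj_holds` gives `a_p = π + π̄` for SOME `π` of norm `p` (unsigned); the
sign law is what the Hecke-theta dictionary of the sequel files needs.  Nothing about BSD is proved here.

## References
* K. S. Williams, *Note on Brewer's character sum*, Proc. Amer. Math. Soc. 71 (1978), 153–154. [Williams1978]
* B. W. Brewer, *On certain character sums*, Trans. Amer. Math. Soc. 99 (1961), 241–245. [Brewer1961]
* P. A. Leonard, K. S. Williams, *Jacobi sums and a theorem of Brewer*, Rocky Mountain J. Math. 5 (1975), 301–308,
  Theorem (p. 301). [LeonardWilliams1975]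
* A. R. Rajwade, *Arithmetic on curves with complex multiplication by √−2*, Proc. Cambridge Philos. Soc. 64 (1968),
  659–672. [Rajwade1968]
* A. Silverberg, *Group order formulas for reductions of CM elliptic curves*, Contemp. Math. 521 (2010), Thm. 2.7.
  [Silverberg2010]
* K. Ireland, M. Rosen, *A Classical Introduction to Modern Number Theory*, 2nd ed., GTM 84 (1990), Ch. 5 §1, Ch. 18 §4.
  [IrelandRosen1990]
* J. H. Silverman, *Advanced Topics in the Arithmetic of Elliptic Curves*, GTM 151 (1994), Prop. II.2.3.1(ii).
  [SilvermanAdvancedTopics1994]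

## Mathlib / tree search
Tree: `WeierstrassCurve.natCard_point_eq_one_add_card`, `card_filter_sq_add_mul_eq` (`PointCountEulerCriterion`),
`Automorphic.lFunction_map_apply_prime_of_not_dvd`, `Automorphic.frobeniusTrace/numPointsMod` (`LangWave0[Proofs]`),
`hasGoodReductionAt_map_of_not_dvd` (`CongruentNumberCurveSupersingular`), `DeuringSqrtTwo.*` (the `[√-2]` endomorphism,
not used).  Mathlib: `quadraticChar_card_sqrts`, `quadraticChar_sum_zero`, `quadraticChar_sq_one'`, `quadraticChar_neg_two`,
`ZMod.χ₈'_nat_eq_if_mod_eight`.  `lean search '4 \* x \^ 2 \+ 2 \* x|⟨0, 4, 0, 2, 0⟩'`: only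
`DeuringSplitOrdinarySqrtTwoProofs` / `DeuringSupersingularReductionHoldsProofs` (no point count); the Summits-side
`…SqrtTwoCorner.j_B / isElliptic_Bfam` (not importable here) have the same models.
-/

noncomputable section

open Finset

namespace Literature.NumberTheory.EllipticCurves

namespace SqrtTwoTwist

/-! ### §1 The models `B_n = ⟨0, 4n, 0, 2n², 0⟩` over `ℤ`, `ℚ` and `ℤ/p` -/

/-- The `ℤ`-model of `B_n` base-changes along any ring map to `⟨0, 4n, 0, 2n², 0⟩`. [cite: Rajwade1968, §1] [cite: Silverberg2010, Thm. 2.7] -/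
theorem map_int {R : Type*} [CommRing R] (f : ℤ →+* R) (n : ℤ) :
    (⟨0, 4 * n, 0, 2 * n ^ 2, 0⟩ : WeierstrassCurve ℤ).map f = ⟨0, 4 * (n : R), 0, 2 * (n : R) ^ 2, 0⟩ := by
  simp [WeierstrassCurve.map]

/-- The `ℤ`-model of `B_n` base-changes to `B_n / ℚ`. [cite: Rajwade1968, §1] [cite: Silverberg2010, Thm. 2.7] -/
theorem map_int_rat (n : ℤ) :
    (⟨0, 4 * n, 0, 2 * n ^ 2, 0⟩ : WeierstrassCurve ℤ).map (Int.castRingHom ℚ) =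
      (⟨0, 4 * (n : ℚ), 0, 2 * (n : ℚ) ^ 2, 0⟩ : WeierstrassCurve ℚ) :=
  map_int _ n

/-- **`Δ(B_n) = 2⁹ n⁶`** over any commutative ring (`b₂ = 16n`, `b₄ = 4n²`, `b₆ = 0`, `b₈ = −4n⁴`; for `n = 1` this is
Cremona's `Δ(256d1) = 2⁹`). [cite: SilvermanAdvancedTopics1994, App. A §3 (the CM curves over ℚ)] -/
theorem Δ_B {R : Type*} [CommRing R] (n : R) :
    (⟨0, 4 * n, 0, 2 * n ^ 2, 0⟩ : WeierstrassCurve R).Δ = 512 * n ^ 6 := by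
  simp only [WeierstrassCurve.Δ, WeierstrassCurve.b₂, WeierstrassCurve.b₄, WeierstrassCurve.b₆,
    WeierstrassCurve.b₈]
  ring

/-- `c₄(B_n) = 160 n²`. [cite: SilvermanAdvancedTopics1994, App. A §3] -/
theorem c₄_B {R : Type*} [CommRing R] (n : R) :
    (⟨0, 4 * n, 0, 2 * n ^ 2, 0⟩ : WeierstrassCurve R).c₄ = 160 * n ^ 2 := by
  simp only [WeierstrassCurve.c₄, WeierstrassCurve.b₂, WeierstrassCurve.b₄]
  ring

/-- `B_n` is an elliptic curve over a field in which `2n ≠ 0`. [cite: Rajwade1968, §1] [cite: Silverberg2010, Thm. 2.7] -/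
theorem isElliptic_B {K : Type*} [Field K] {n : K} (hn : n ≠ 0) (h2 : (2 : K) ≠ 0) :
    (⟨0, 4 * n, 0, 2 * n ^ 2, 0⟩ : WeierstrassCurve K).IsElliptic := by
  rw [WeierstrassCurve.isElliptic_iff, Δ_B, isUnit_iff_ne_zero]
  have : (512 : K) = 2 ^ 9 := by norm_num
  rw [this]; exact mul_ne_zero (pow_ne_zero _ h2) (pow_ne_zero _ hn)

/-- `B_n / ℚ` is an elliptic curve for `n ≠ 0`. [cite: Rajwade1968, §1] [cite: Silverberg2010, Thm. 2.7] -/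
theorem isElliptic_B_rat {n : ℤ} (hn : n ≠ 0) :
    (⟨0, 4 * (n : ℚ), 0, 2 * (n : ℚ) ^ 2, 0⟩ : WeierstrassCurve ℚ).IsElliptic :=
  isElliptic_B (Int.cast_ne_zero.mpr hn) two_ne_zero

/-- A prime `p ∤ 2n` does not divide `Δ(B_n) = 2⁹ n⁶`. [cite: Rajwade1968, Theorem 1] [cite: Silverberg2010, Thm. 2.7] -/
theorem not_dvd_Δ_B_int {p : ℕ} (hp : p.Prime) {n : ℤ} (h : ¬ (p : ℤ) ∣ 2 * n) :
    ¬ (p : ℤ) ∣ (⟨0, 4 * n, 0, 2 * n ^ 2, 0⟩ : WeierstrassCurve ℤ).Δ := by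
  rw [Δ_B]
  have hp' : Prime (p : ℤ) := Nat.prime_iff_prime_int.mp hp
  intro hd
  rcases hp'.dvd_or_dvd hd with h512 | hn
  · exact h ((hp'.dvd_of_dvd_pow (show (p : ℤ) ∣ 2 ^ 9 by norm_num at h512 ⊢; exact h512)).mul_right n)
  · exact h ((hp'.dvd_of_dvd_pow hn).mul_left 2)

/-- For a prime `p ∤ 2n`, the reduction of the `ℤ`-model of `B_n` modulo `p` is an elliptic curve. [cite: Rajwade1968, Theorem 1] [cite: Silverberg2010, Thm. 2.7] -/
theorem isElliptic_B_zmod {p : ℕ} [Fact p.Prime] {n : ℤ} (h : ¬ (p : ℤ) ∣ 2 * n) :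
    ((⟨0, 4 * n, 0, 2 * n ^ 2, 0⟩ : WeierstrassCurve ℤ).map (Int.castRingHom (ZMod p))).IsElliptic := by
  rw [WeierstrassCurve.isElliptic_iff, WeierstrassCurve.map_Δ, isUnit_iff_ne_zero, eq_intCast]
  intro h0
  exact not_dvd_Δ_B_int (Fact.out) h ((ZMod.intCast_zmod_eq_zero_iff_dvd _ p).mp h0)

/-! ### §2 Point counts over a finite field: `#⟨0, a, 0, b, 0⟩(F) = |F| + 1 + Σ_x χ(x³ + a x² + b x)` and the twist law -/

section FiniteField

variable {F : Type*} [Field F] [Fintype F] [DecidableEq F]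

/-- **`#E(F) = |F| + 1 + Σ_x χ(x³ + a x² + b x)`** for `E = ⟨0, a, 0, b, 0⟩ nonsingular over a finite field of odd
characteristic: `#E(F) = 1 + Σ_x #{y : y² = x³ + ax² + bx}` and `#{y : y² = t} = 1 + χ(t)` (Mathlib's
`quadraticChar_card_sqrts`). [cite: IrelandRosen1990, Ch. 18 §4, proof of Theorem 5 (PDF p. 300)] -/
theorem natCard_point_eq_card_add_one_add_sum (hF : ringChar F ≠ 2) (a b : F)
    (hΔ : (⟨0, a, 0, b, 0⟩ : WeierstrassCurve F).Δ ≠ 0) :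
    (Nat.card (⟨0, a, 0, b, 0⟩ : WeierstrassCurve F).toAffine.Point : ℤ) =
      Fintype.card F + 1 + ∑ x : F, quadraticChar F (x ^ 3 + a * x ^ 2 + b * x) := by
  rw [WeierstrassCurve.natCard_point_eq_one_add_card _ hΔ,
    Fintype.card_congr (Equiv.subtypeProdEquivSigmaSubtype (fun x y : F =>
      y ^ 2 + (0 : F) * x * y + 0 * y = x ^ 3 + a * x ^ 2 + b * x + 0)), Fintype.card_sigma]
  push_cast
  have hcol : ∀ x : F, (Fintype.card {y : F // y ^ 2 + (0 : F) * x * y + 0 * y = x ^ 3 + a * x ^ 2 + b * x + 0} : ℤ)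
      = quadraticChar F (x ^ 3 + a * x ^ 2 + b * x) + 1 := by
    intro x
    have hset : (univ.filter fun y : F ↦ y ^ 2 + (0 : F) * x * y + 0 * y = x ^ 3 + a * x ^ 2 + b * x + 0) =
        {y : F | y ^ 2 = x ^ 3 + a * x ^ 2 + b * x}.toFinset := by
      ext y; simp
    rw [Fintype.card_subtype, hset, quadraticChar_card_sqrts hF]
  simp_rw [hcol]
  rw [Finset.sum_add_distrib, Finset.sum_const, Finset.card_univ, nsmul_eq_mul, mul_one]
  ring

/-- **The twist law** `Σ_x χ(x³ + a n x² + b n² x) = χ(n) Σ_x χ(x³ + a x² + b x)` for `n ≠ 0`: substitute `x ↦ n x` and use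
`χ(n³) = χ(n)` (so the twist `B_n` of `B` by `n` has `a_p(B_n) = (n/p) a_p(B)` at the primes `p ∤ 2n`).
[cite: Rajwade1968, §1 (the family y² = x(x² − 4ax + 2a²))] -/
theorem sum_quadraticChar_twist (a b : F) {n : F} (hn : n ≠ 0) :
    ∑ x : F, quadraticChar F (x ^ 3 + a * n * x ^ 2 + b * n ^ 2 * x) =
      quadraticChar F n * ∑ x : F, quadraticChar F (x ^ 3 + a * x ^ 2 + b * x) := by
  rw [Finset.mul_sum]
  refine (Fintype.sum_equiv (Equiv.mulLeft₀ n hn) _ _ fun x ↦ ?_).symm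
  have : (Equiv.mulLeft₀ n hn x) ^ 3 + a * n * (Equiv.mulLeft₀ n hn x) ^ 2 + b * n ^ 2 * (Equiv.mulLeft₀ n hn x) =
      n ^ 2 * (n * (x ^ 3 + a * x ^ 2 + b * x)) := by
    change (n * x) ^ 3 + a * n * (n * x) ^ 2 + b * n ^ 2 * (n * x) = _; ring
  rw [this, map_mul, quadraticChar_sq_one' hn, one_mul, map_mul]

/-! ### §3 Williams' theorem: `Σ_x χ(x³ + 4x² + 2x) = 0` when `χ(−2) = −1` -/

/-- For `x ≠ 0`: `χ(x³ + 4x² + 2x) = χ(x + 4 + 2/x)` (pull out the square `x²`). [cite: Williams1978, p. 153, display 2] -/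
theorem quadraticChar_cubic_eq_of_ne_zero {x : F} (hx : x ≠ 0) :
    quadraticChar F (x ^ 3 + 4 * x ^ 2 + 2 * x) = quadraticChar F (x + 4 + 2 / x) := by
  have : x ^ 3 + 4 * x ^ 2 + 2 * x = x ^ 2 * (x + 4 + 2 / x) := by field_simp
  rw [this, map_mul, quadraticChar_sq_one' hx, one_mul]

/-- The fibre of `x ↦ x + 2/x` on `F ∖ 0` over `y` is `{x : x² − yx + 2 = 0}`, of cardinality `1 + χ(y² − 8)` (odd
characteristic). [cite: Williams1978, p. 153, last display] -/
theorem card_fiber_add_two_div (hF : ringChar F ≠ 2) (y : F) :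
    ((({x ∈ (univ : Finset F) | x ≠ 0 ∧ x + 2 / x = y} : Finset F)).card : ℤ) = quadraticChar F (y ^ 2 - 8) + 1 := by
  have h2 : (2 : F) ≠ 0 := Ring.two_ne_zero hF
  have h := card_filter_sq_add_mul_eq hF (-y) (-2 : F)
  have hy : (-y) ^ 2 + 4 * (-2 : F) = y ^ 2 - 8 := by ring
  rw [hy] at h
  rw [← h]
  congr 2
  ext x
  simp only [mem_filter, mem_univ, true_and]
  constructor
  · rintro ⟨hx, rfl⟩
    field_simp
    ring
  · intro hx2
    have hx : x ≠ 0 := by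
      rintro rfl
      exact h2 (by linear_combination hx2)
    refine ⟨hx, ?_⟩
    field_simp
    linear_combination hx2

/-- **Williams' identity**: `Σ_x χ(x³ + 4x² + 2x) = χ(−2) · Σ_x χ(x³ + 4x² + 2x)` over a finite field of odd characteristic.
Proof (PAMS 71): the sum is `Σ_{x ≠ 0} χ(x + 4 + 2/x) = Σ_y (1 + χ(y² − 8)) χ(y + 4) = Σ_y χ((y + 4)(y² − 8))`
(`Σ_y χ(y + 4) = 0`), and `y = −2z − 2… ` precisely `y ↦ −2y` followed by `y ↦ y + 2` turns `(y + 4)(y² − 8)` into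
`−8 · (x³ + 4x² + 2x)`. [cite: Williams1978, pp. 153–154] -/
theorem sum_quadraticChar_B_eq_mul_self (hF : ringChar F ≠ 2) :
    ∑ x : F, quadraticChar F (x ^ 3 + 4 * x ^ 2 + 2 * x) =
      quadraticChar F (-2) * ∑ x : F, quadraticChar F (x ^ 3 + 4 * x ^ 2 + 2 * x) := by
  set S := ∑ x : F, quadraticChar F (x ^ 3 + 4 * x ^ 2 + 2 * x) with hS
  have h2 : (2 : F) ≠ 0 := Ring.two_ne_zero hF
  -- Step 1: restrict to `x ≠ 0` and rewrite the summand as `χ(x + 4 + 2/x)`.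
  have step1 : S = ∑ x ∈ (univ : Finset F).filter (· ≠ 0), quadraticChar F (x + 4 + 2 / x) := by
    rw [hS, ← Finset.sum_filter_add_sum_filter_not univ (fun x : F ↦ x ≠ 0)]
    have h0 : ∑ x ∈ univ.filter (fun x : F ↦ ¬ x ≠ 0), quadraticChar F (x ^ 3 + 4 * x ^ 2 + 2 * x) = 0 := by
      have : univ.filter (fun x : F ↦ ¬ x ≠ 0) = {0} := by ext x; simp
      rw [this, sum_singleton]; simp
    rw [h0, add_zero]
    exact Finset.sum_congr rfl fun x hx ↦ quadraticChar_cubic_eq_of_ne_zero (mem_filter.mp hx).2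
  -- Step 2: group by the value `y = x + 2/x`.
  have step2 : ∑ x ∈ (univ : Finset F).filter (· ≠ 0), quadraticChar F (x + 4 + 2 / x) =
      ∑ y : F, (quadraticChar F (y ^ 2 - 8) + 1) * quadraticChar F (y + 4) := by
    rw [← Finset.sum_fiberwise (univ.filter (· ≠ 0)) (fun x : F ↦ x + 2 / x)
      (fun x ↦ quadraticChar F (x + 4 + 2 / x))]
    refine Finset.sum_congr rfl fun y _ ↦ ?_
    have hin : ∀ x ∈ (univ.filter (· ≠ (0 : F))).filter (fun x ↦ x + 2 / x = y),
        quadraticChar F (x + 4 + 2 / x) = quadraticChar F (y + 4) := by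
      intro x hx
      simp only [mem_filter, mem_univ, true_and] at hx
      rw [← hx.2]; ring_nf
    rw [Finset.sum_congr rfl hin, sum_const, nsmul_eq_mul]
    congr 1
    rw [← card_fiber_add_two_div hF y, Finset.filter_filter]
  -- Step 3: `Σ_y χ(y + 4) = 0`, leaving `Σ_y χ((y + 4)(y² − 8))`.
  have step3 : ∑ y : F, (quadraticChar F (y ^ 2 - 8) + 1) * quadraticChar F (y + 4) =
      ∑ y : F, quadraticChar F ((y + 4) * (y ^ 2 - 8)) := by
    have hlin : ∑ y : F, quadraticChar F (y + 4) = 0 := by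
      rw [Fintype.sum_equiv (Equiv.addRight (4 : F)) (fun y ↦ quadraticChar F (y + 4)) (quadraticChar F) fun _ ↦ rfl]
      exact quadraticChar_sum_zero hF
    calc ∑ y : F, (quadraticChar F (y ^ 2 - 8) + 1) * quadraticChar F (y + 4)
        = ∑ y : F, (quadraticChar F ((y + 4) * (y ^ 2 - 8)) + quadraticChar F (y + 4)) :=
          Finset.sum_congr rfl fun y _ ↦ by rw [add_mul, one_mul, map_mul, mul_comm]
      _ = ∑ y : F, quadraticChar F ((y + 4) * (y ^ 2 - 8)) := by
          rw [Finset.sum_add_distrib, hlin, add_zero]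
  -- Step 4: `y = −2(z + 2)`: `(y + 4)(y² − 8) = −8 (z³ + 4z² + 2z)`.
  have step4 : ∑ y : F, quadraticChar F ((y + 4) * (y ^ 2 - 8)) = quadraticChar F (-2) * S := by
    rw [hS, Finset.mul_sum]
    refine (Fintype.sum_equiv ((Equiv.addRight (2 : F)).trans (Equiv.mulLeft₀ (-2 : F) (by simpa using h2))) _ _
      fun z ↦ ?_).symm
    change quadraticChar F (-2) * quadraticChar F (z ^ 3 + 4 * z ^ 2 + 2 * z) =
      quadraticChar F ((-2 * (z + 2) + 4) * ((-2 * (z + 2)) ^ 2 - 8))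
    have : (-2 * (z + 2) + 4) * ((-2 * (z + 2)) ^ 2 - 8) = 2 ^ 2 * ((-2) * (z ^ 3 + 4 * z ^ 2 + 2 * z)) := by
      ring
    rw [this, map_mul, map_mul, quadraticChar_sq_one' h2, one_mul]
  exact step1.trans (step2.trans (step3.trans step4))

/-- ★ **Williams 1978: `Σ_x χ(x³ + 4x² + 2x) = 0` over a finite field in which `−2` is a non-square** (odd characteristic;
over `𝔽_p`: `p ≡ 5, 7 (mod 8)`): the elementary proof of `B = Σ ((x + 2)(x² − 2)/p) = 0`, "which appears to have been
overlooked". [cite: Williams1978, Abstract and pp. 153–154] -/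
theorem sum_quadraticChar_B_eq_zero (hF : ringChar F ≠ 2) (h2 : quadraticChar F (-2) = -1) :
    ∑ x : F, quadraticChar F (x ^ 3 + 4 * x ^ 2 + 2 * x) = 0 := by
  have h := sum_quadraticChar_B_eq_mul_self (F := F) hF
  rw [h2] at h
  linarith

/-- The twisted sums vanish too: `Σ_x χ(x³ + 4n x² + 2n² x) = 0` for every `n` when `χ(−2) = −1` (twist law for `n ≠ 0`;
for `n = 0` the sum is `Σ χ(x³) = Σ χ(x) · χ(x)² …` — directly `x ↦ x³` is not needed: `χ(x³) = χ(x)` for all `x`).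
[cite: Williams1978, pp. 153–154] [cite: Rajwade1968, §1] -/
theorem sum_quadraticChar_Bn_eq_zero (hF : ringChar F ≠ 2) (h2 : quadraticChar F (-2) = -1) (n : F) :
    ∑ x : F, quadraticChar F (x ^ 3 + 4 * n * x ^ 2 + 2 * n ^ 2 * x) = 0 := by
  by_cases hn : n = 0
  · subst hn
    have h0 : ∀ x : F, x ^ 3 + 4 * 0 * x ^ 2 + 2 * 0 ^ 2 * x = x ^ 3 := fun x ↦ by ring
    have : ∀ x : F, quadraticChar F (x ^ 3) = quadraticChar F x := by
      intro x
      by_cases hx : x = 0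
      · rw [hx]; simp
      · rw [pow_succ, map_mul, quadraticChar_sq_one' hx, one_mul]
    simp_rw [h0, this]
    exact quadraticChar_sum_zero hF
  · rw [sum_quadraticChar_twist 4 2 hn, sum_quadraticChar_B_eq_zero hF h2, mul_zero]

/-- `χ(−2) = −1` in a finite field with `|F| ≡ 5` or `7 (mod 8)`. [cite: IrelandRosen1990, Ch. 5 §1, Prop. 5.1.3] -/
theorem quadraticChar_neg_two_eq_neg_one (hF : Fintype.card F % 8 = 5 ∨ Fintype.card F % 8 = 7) :
    quadraticChar F (-2) = -1 := by
  have hodd : ringChar F ≠ 2 := by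
    intro h
    have := FiniteField.even_card_iff_char_two.mp h
    rcases hF with h | h <;> omega
  rw [quadraticChar_neg_two hodd, ZMod.χ₈'_nat_eq_if_mod_eight]
  have h1 : Fintype.card F % 2 ≠ 0 := by rcases hF with h | h <;> omega
  have h2 : ¬ (Fintype.card F % 8 = 1 ∨ Fintype.card F % 8 = 3) := by rcases hF with h | h <;> omega
  rw [if_neg h1, if_neg h2]

/-- ★ **`#B_n(F) = |F| + 1` over a finite field with `|F| ≡ 5, 7 (mod 8)`** in which `B_n` is nonsingular: the supersingular
primes of the `j = 8000` family are the primes inert in `ℚ(√-2)`. [cite: Williams1978, pp. 153–154] [cite: Rajwade1968, §1] -/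
theorem natCard_point_B_eq_of_card_mod_eight (hF : Fintype.card F % 8 = 5 ∨ Fintype.card F % 8 = 7) (n : F)
    (hΔ : (⟨0, 4 * n, 0, 2 * n ^ 2, 0⟩ : WeierstrassCurve F).Δ ≠ 0) :
    Nat.card (⟨0, 4 * n, 0, 2 * n ^ 2, 0⟩ : WeierstrassCurve F).toAffine.Point = Fintype.card F + 1 := by
  have hodd : ringChar F ≠ 2 := by
    intro h
    have := FiniteField.even_card_iff_char_two.mp h
    rcases hF with h | h <;> omega
  have h := natCard_point_eq_card_add_one_add_sum hodd (4 * n) (2 * n ^ 2) hΔ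
  rw [sum_quadraticChar_Bn_eq_zero hodd (quadraticChar_neg_two_eq_neg_one hF) n, add_zero] at h
  exact_mod_cast h

end FiniteField

/-! ### §4 `a_p(B_n) = 0` for `p ≡ 5, 7 (mod 8)`, `p ∤ n` -/

/-- **`#B̃_n(𝔽_p) = p + 1`** for a prime `p ≡ 5, 7 (mod 8)` with `p ∤ n`, in the tree's normalisation `numPointsMod` (points
of the reduction of the `ℤ`-model, with `O`). [cite: Williams1978, pp. 153–154] [cite: Rajwade1968, §1] -/
theorem numPointsMod_B {p : ℕ} (hp : p.Prime) (hp8 : p % 8 = 5 ∨ p % 8 = 7) {n : ℤ} (hpn : ¬ (p : ℤ) ∣ n) :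
    Literature.NumberTheory.Automorphic.numPointsMod (⟨0, 4 * n, 0, 2 * n ^ 2, 0⟩ : WeierstrassCurve ℤ) p = p + 1 := by
  haveI := Fact.mk hp
  have hp2 : p ≠ 2 := by rintro rfl; norm_num at hp8
  have h2n : ¬ (p : ℤ) ∣ 2 * n := by
    intro h
    rcases (Nat.prime_iff_prime_int.mp hp).dvd_or_dvd h with h | h
    · exact hp2 ((Nat.prime_dvd_prime_iff_eq hp Nat.prime_two).mp (by exact_mod_cast h))
    · exact hpn h
  haveI hE := isElliptic_B_zmod (p := p) h2n
  unfold Literature.NumberTheory.Automorphic.numPointsMod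
  rw [map_int] at hE ⊢
  have hcard : Fintype.card (ZMod p) % 8 = 5 ∨ Fintype.card (ZMod p) % 8 = 7 := by rwa [ZMod.card]
  rw [natCard_point_B_eq_of_card_mod_eight hcard _ (hE.isUnit.ne_zero), ZMod.card]

/-- **`a_p(B_n) = 0` on the `ℤ`-model** at a prime `p ≡ 5, 7 (mod 8)`, `p ∤ n`. [cite: Williams1978, pp. 153–154] -/
theorem frobeniusTrace_B_eq_zero {p : ℕ} (hp : p.Prime) (hp8 : p % 8 = 5 ∨ p % 8 = 7) {n : ℤ} (hpn : ¬ (p : ℤ) ∣ n) :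
    Literature.NumberTheory.Automorphic.frobeniusTrace (⟨0, 4 * n, 0, 2 * n ^ 2, 0⟩ : WeierstrassCurve ℤ) p = 0 := by
  rw [Literature.NumberTheory.Automorphic.frobeniusTrace, numPointsMod_B hp hp8 hpn]
  push_cast
  ring

/-- ★ **`a_p(B_n) = 0` for every prime `p ≡ 5, 7 (mod 8)` not dividing `n`** — the `p`-th Dirichlet coefficient of Mathlib's
`WeierstrassCurve.LFunction` of `B_n / ℚ` vanishes at the primes inert in `ℚ(√-2)` (the supersingular half of Deuring's
theorem for `j = 8000`, with Williams' elementary proof; `p ∤ Δ = 2⁹ n⁶` of the `ℤ`-model and the tree's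
`lFunction_map_apply_prime_of_not_dvd`). [cite: Williams1978, pp. 153–154] [cite: Rajwade1968, §1] -/
theorem lFunction_B_apply_prime_eq_zero {p : ℕ} (hp : p.Prime) (hp8 : p % 8 = 5 ∨ p % 8 = 7) {n : ℤ}
    (hpn : ¬ (p : ℤ) ∣ n) : (⟨0, 4 * (n : ℚ), 0, 2 * (n : ℚ) ^ 2, 0⟩ : WeierstrassCurve ℚ).LFunction p = 0 := by
  have hp2 : p ≠ 2 := by rintro rfl; norm_num at hp8
  have h2n : ¬ (p : ℤ) ∣ 2 * n := by
    intro h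
    rcases (Nat.prime_iff_prime_int.mp hp).dvd_or_dvd h with h | h
    · exact hp2 ((Nat.prime_dvd_prime_iff_eq hp Nat.prime_two).mp (by exact_mod_cast h))
    · exact hpn h
  rw [← map_int_rat, Literature.NumberTheory.Automorphic.lFunction_map_apply_prime_of_not_dvd _ hp
    (not_dvd_Δ_B_int hp h2n), frobeniusTrace_B_eq_zero hp hp8 hpn]

/-! ### §5 The split primes: reduction to Brewer's character sum -/

section Brewer

variable {F : Type*} [Field F] [Fintype F] [DecidableEq F]

/-- `Σ_x χ(x³ + 4x² + 2x) = χ(−1) · Σ_x χ((x + 2)(x² − 2))` (substitute `x ↦ −x − 2`: `x³ + 4x² + 2x = x((x + 2)² − 2)`), the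
right-hand sum being Brewer's character sum `B = Σ ((x + 2)(x² − 2)/p)` (evaluated at `p ≡ 1, 3 (mod 8)` in the sequel
`SqrtTwoTwistBrewer`). [cite: Williams1978, p. 153 (x ↦ x − 2)] [cite: LeonardWilliams1975, (1.1)] -/
theorem sum_quadraticChar_B_eq_brewer :
    ∑ x : F, quadraticChar F (x ^ 3 + 4 * x ^ 2 + 2 * x) =
      quadraticChar F (-1) * ∑ x : F, quadraticChar F ((x + 2) * (x ^ 2 - 2)) := by
  rw [Finset.mul_sum]
  refine Fintype.sum_equiv ((Equiv.neg F).trans (Equiv.addRight (-2 : F))) _ _ fun x ↦ ?_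
  change quadraticChar F (x ^ 3 + 4 * x ^ 2 + 2 * x) = quadraticChar F (-1) * quadraticChar F ((-x + -2 + 2) * ((-x + -2) ^ 2 - 2))
  rw [← map_mul]
  congr 1
  ring

/-- `Σ_x χ((x + 2)(x² − 2)) = 0` when `χ(−2) = −1` (Brewer's first clause, `p ≡ 5, 7 (mod 8)`, by Williams' proof).
[cite: Williams1978, Abstract] [cite: Brewer1961, Theorem 2] -/
theorem sum_quadraticChar_brewer_eq_zero (hF : ringChar F ≠ 2) (h2 : quadraticChar F (-2) = -1) :
    ∑ x : F, quadraticChar F ((x + 2) * (x ^ 2 - 2)) = 0 := by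
  have h := sum_quadraticChar_B_eq_brewer (F := F)
  rw [sum_quadraticChar_B_eq_zero hF h2] at h
  have hm1 : quadraticChar F (-1) ≠ 0 := by
    rw [Ne, quadraticChar_eq_zero_iff]
    exact neg_ne_zero.mpr one_ne_zero
  exact (mul_eq_zero.mp h.symm).resolve_left hm1

end Brewer

end SqrtTwoTwist

end Literature.NumberTheory.EllipticCurves

end
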